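import Summits.HubbardSuperconductivity.HubbardSuperconductivity.Theorems.LevyLogBootstrapBlock2InfDivXXZKernelCovariance
import Literature.Probability.LatticeModels.TorusNegTypeBochner
import Literature.Analysis.Matrix.SchoenbergKernelsProofs
import HarnessLib

/-!
# Crux `Block2InfDivXXZ` (stmt-HubbardSuperconductivity-15048, route `LevyLogBootstrap`):
# the 2×2-block kernel lives on the coarse torus; Lévy coefficients ⇒ negative type

Support file for the open stub `stub_blockLogNegType` of line `birth`
(`Cruxes/Block2InfDivXXZ/Lines/birth.lean`): "`-log K₂` is a negative definite kernel", `K₂` the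
2×2-block transverse kernel of a normalised `S^z_tot = 0` sector ground state `ψ` of
`H_M(Δ) = xxzHamiltonian 1 (torusGraph 2 M) (-1) Δ`, fine-indexed as in the crux:
`K₂(x, y) = Σ_{x' ∈ block x, y' ∈ block y} Re⟨ψ, S⁺_{x'} S⁻_{y'} ψ⟩`, `block x = (⌊x₀/2⌋, ⌊x₁/2⌋)`.

Writing `M = 2m`, `β : (ℤ/M)² → (ℤ/m)²` for the block (coarse) coordinate `x ↦ (⌊x_i/2⌋)_i` and
`k₂(X) = Σ_{β x' = X, β y' = 0} Re⟨ψ, S⁺_{x'} S⁻_{y'} ψ⟩` for the block kernel between block `X`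
and block `0`, this file proves (from the translation covariance and symmetry of the raw kernel,
`Theorems/LevyLogBootstrapBlock2InfDivXXZKernelCovariance.lean`):

* `coarse_add_double` — `β (x + 2V) = β x + V` (even translations act on blocks);
* `block2Kernel_eq_coarse` — `K₂(x, y) = k₂(β x - β y)` (FACTORISATION through the coarse torus);
* `coarseKernel_neg` — `k₂(-X) = k₂(X)`;
* `stub_blockLogNegType_of_levyCoeff` (registered sub-goal) — if all LÉVY COEFFICIENTS
  `ν_q = Σ_X log k₂(X) Re χ_q(X)`, `q ≠ 0` in `(ℤ/m)²`, are nonnegative, then `-log K₂` is a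
  negative definite kernel (Bochner on the finite torus, negative-type form:
  `Literature.Probability.LatticeModels.isNegDefKernel_neg_of_factor_torus`). This is the seam
  "finitely many sign conditions `ν_q ≥ 0` ⇒ stub 2" announced in the skeleton's docstring; the
  converse and the assembled form `(∀ ν_q ≥ 0) → Block2InfDivXXZ` are in the sibling file
  `…LevyEquivalence.lean`.

Sources: Berg–Christensen–Ressel (1984) Ch. 3 Def. 1.1, Ch. 4 §3; Rudin (1962) §1.4.3 (Bochner);
Tasaki (2020) §2.1, §2.4; card `levy-mass-log-bootstrap` (K1, block form). No definition is
introduced (`β`, `k₂` appear as explicit lambda terms); sorry-free.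
-/

noncomputable section

set_option linter.dupNamespace false

namespace Summit.HubbardSuperconductivity.HubbardSuperconductivity.Theorems.LevyLogBootstrap

open scoped BigOperators Matrix ComplexOrder ComplexConjugate
open Matrix Finset Complex
open Literature.MathematicalPhysics.QuantumLattice Literature.Probability.LatticeModels
open Literature.Analysis.Matrix

/-! ### Block (coarse) coordinates on the even torus -/

section Coarse

variable {M m : ℕ} [NeZero M] [NeZero m]

omit [NeZero m] in
/-- Components of a fine site have `⌊x_i/2⌋ < m` when `M = 2m`. [folklore] -/
theorem val_div_two_lt (hM : M = 2 * m) (x : TorusSite 2 M) (i : Fin 2) : (x i).val / 2 < m := by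
  have h := ZMod.val_lt (x i)
  omega

omit [NeZero M] [NeZero m] in
/-- Casting small naturals into `ℤ/m` is injective: for `a, b < m`, `(a : ZMod m) = b ↔ a = b`. [folklore] -/
theorem natCast_zmod_inj_of_lt {a b : ℕ} (ha : a < m) (hb : b < m) :
    ((a : ZMod m) = (b : ZMod m)) ↔ a = b := by
  rw [ZMod.natCast_eq_natCast_iff', Nat.mod_eq_of_lt ha, Nat.mod_eq_of_lt hb]

omit [NeZero m] in
/-- **Block membership is equality of coarse coordinates**: for fine sites `x', x` of `(ℤ/2m)²`,
`(∀ i, ⌊x'_i/2⌋ = ⌊x_i/2⌋) ↔ β x' = β x` with `β x = (⌊x_i/2⌋ mod m)_i`. [folklore] -/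
theorem block_iff_coarse_eq (hM : M = 2 * m) (x' x : TorusSite 2 M) :
    (∀ i : Fin 2, (x' i).val / 2 = (x i).val / 2) ↔
      (fun i : Fin 2 => (((x' i).val / 2 : ℕ) : ZMod m)) =
        fun i : Fin 2 => (((x i).val / 2 : ℕ) : ZMod m) := by
  rw [funext_iff]
  refine forall_congr' fun i => ?_
  rw [natCast_zmod_inj_of_lt (val_div_two_lt hM x' i) (val_div_two_lt hM x i)]

/-- Block membership relative to a coarse site `X`: `(∀ i, ⌊x'_i/2⌋ = X_i.val) ↔ β x' = X`. [folklore] -/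
theorem block_iff_coarse_eq' (hM : M = 2 * m) (x' : TorusSite 2 M) (X : TorusSite 2 m) :
    (∀ i : Fin 2, (x' i).val / 2 = (X i).val) ↔
      (fun i : Fin 2 => (((x' i).val / 2 : ℕ) : ZMod m)) = X := by
  rw [funext_iff]
  refine forall_congr' fun i => ?_
  rw [← natCast_zmod_inj_of_lt (m := m) (val_div_two_lt hM x' i) (ZMod.val_lt (X i)),
    ZMod.natCast_zmod_val]

/-- **Even translations act on blocks**: `β (x + 2V) = β x + V`, where the even fine vector
`2V ∈ (ℤ/2m)²` has components `2 · V_i.val`. (`⌊(a + 2b) mod 2m⌋/2 ≡ ⌊a/2⌋ + b (mod m)`.) [folklore] -/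
theorem coarse_add_double (hM : M = 2 * m) (x : TorusSite 2 M) (V : TorusSite 2 m) :
    (fun i : Fin 2 => ((((x + fun j => ((2 * (V j).val : ℕ) : ZMod M)) i).val / 2 : ℕ) : ZMod m)) =
      (fun i : Fin 2 => (((x i).val / 2 : ℕ) : ZMod m)) + V := by
  subst hM
  funext i
  simp only [Pi.add_apply]
  have hval : (x i + ((2 * (V i).val : ℕ) : ZMod (2 * m))).val =
      ((x i).val + 2 * (V i).val) % (2 * m) := by
    rw [ZMod.val_add, ZMod.val_natCast, Nat.add_mod_mod]
  rw [hval, Nat.mod_mul_right_div_self, Nat.add_mul_div_left _ _ Nat.two_pos, ZMod.natCast_mod,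
    Nat.cast_add, ZMod.natCast_zmod_val]

/-- The coarse coordinate of an even fine vector: `β (2V) = V`. [folklore] -/
theorem coarse_double (hM : M = 2 * m) (V : TorusSite 2 m) :
    (fun i : Fin 2 => ((((fun j => ((2 * (V j).val : ℕ) : ZMod M)) i).val / 2 : ℕ) : ZMod m)) = V := by
  have h := coarse_add_double hM 0 V
  rw [zero_add] at h
  rw [h]
  ext i
  simp

end Coarse

/-! ### The block kernel of a sector ground state factors through the coarse torus -/

section Block

variable (M : ℕ) {m : ℕ} [NeZero M] [NeZero m]

/-- **Factorisation of the 2×2-block kernel through the coarse torus.** For even `M = 2m`, every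
real `Δ` and every normalised `S^z_tot = 0` sector ground state `ψ`, the fine-indexed block kernel
of the crux equals the coarse block kernel at the difference of the block coordinates:
`K₂(x, y) = k₂(β x - β y)`, `k₂(X) = Σ_{β x' = X, β y' = 0} Re⟨ψ, S⁺_{x'} S⁻_{y'} ψ⟩` — shift both
summation variables by the even vector `2 β y` and use the translation invariance of the raw kernel
(`gs_transverseKernel_translate`). [folklore] -/
theorem block2Kernel_eq_coarse (hM : M = 2 * m) (hEven : Even M) (Δ : ℝ)
    (ψ : TensorIndex (TorusSite 2 M) 2 → ℂ)
    (hψ : ψ ∈ @spinZSector (TorusSite 2 M) _ _ 1 0) (hnorm : star ψ ⬝ᵥ ψ = 1)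
    (heig : Matrix.mulVec (xxzHamiltonian 1 (torusGraph 2 M) (-1) Δ) ψ =
      ((lowestEnergyInSector 1 (xxzHamiltonian 1 (torusGraph 2 M) (-1) Δ) 0 : ℝ) : ℂ) • ψ)
    (x y : TorusSite 2 M) :
    (∑ x' : TorusSite 2 M, ∑ y' : TorusSite 2 M,
      if (∀ i : Fin 2, (x' i).val / 2 = (x i).val / 2) ∧ (∀ i : Fin 2, (y' i).val / 2 = (y i).val / 2)
      then (star ψ ⬝ᵥ (onSite x' (spinRaise 1) * onSite y' (spinLower 1)) *ᵥ ψ).re else 0) =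
    ∑ x' : TorusSite 2 M, ∑ y' : TorusSite 2 M,
      if (∀ i : Fin 2, (x' i).val / 2 =
            (((fun i : Fin 2 => (((x i).val / 2 : ℕ) : ZMod m)) -
              fun i : Fin 2 => (((y i).val / 2 : ℕ) : ZMod m)) i).val) ∧
          (∀ i : Fin 2, (y' i).val / 2 = 0)
      then (star ψ ⬝ᵥ (onSite x' (spinRaise 1) * onSite y' (spinLower 1)) *ᵥ ψ).re else 0 := by
  classical
  -- the coarse coordinate and the even shift `w = 2 β y`
  set β : TorusSite 2 M → TorusSite 2 m := fun z i => (((z i).val / 2 : ℕ) : ZMod m) with hβ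
  set w : TorusSite 2 M := fun j => ((2 * (β y j).val : ℕ) : ZMod M) with hw
  set K : TorusSite 2 M → TorusSite 2 M → ℝ := fun a b =>
    (star ψ ⬝ᵥ (onSite a (spinRaise 1) * onSite b (spinLower 1)) *ᵥ ψ).re with hK
  have hshift : ∀ a : TorusSite 2 M, β (a + w) = β a + β y := fun a => coarse_add_double hM a (β y)
  have hKw : ∀ a b : TorusSite 2 M, K (a + w) (b + w) = K a b := fun a b =>
    gs_transverseKernel_translate M hEven Δ ψ hψ hnorm heig w a b
  -- rewrite both indicator predicates through `β`
  have hL : ∀ a b : TorusSite 2 M,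
      ((∀ i : Fin 2, (a i).val / 2 = (x i).val / 2) ∧ (∀ i : Fin 2, (b i).val / 2 = (y i).val / 2)) ↔
        (β a = β x ∧ β b = β y) := fun a b => by
    rw [block_iff_coarse_eq hM a x, block_iff_coarse_eq hM b y]
  have hzero : ∀ b : TorusSite 2 M, (∀ i : Fin 2, (b i).val / 2 = 0) ↔ β b = 0 := fun b => by
    have := block_iff_coarse_eq' hM b (0 : TorusSite 2 m)
    simpa only [Pi.zero_apply, ZMod.val_zero] using this
  have hR : ∀ a b : TorusSite 2 M,
      ((∀ i : Fin 2, (a i).val / 2 = ((β x - β y) i).val) ∧ (∀ i : Fin 2, (b i).val / 2 = 0)) ↔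
        (β a = β x - β y ∧ β b = 0) := fun a b => by
    rw [block_iff_coarse_eq' hM a (β x - β y), hzero b]
  -- shift the summation variables of the left-hand side by `w`
  calc (∑ x' : TorusSite 2 M, ∑ y' : TorusSite 2 M,
        if (∀ i : Fin 2, (x' i).val / 2 = (x i).val / 2) ∧ (∀ i : Fin 2, (y' i).val / 2 = (y i).val / 2)
        then K x' y' else 0)
      = ∑ x' : TorusSite 2 M, ∑ y' : TorusSite 2 M,
          if β x' = β x ∧ β y' = β y then K x' y' else 0 := by
        refine Finset.sum_congr rfl fun a _ => Finset.sum_congr rfl fun b _ => ?_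
        rw [if_congr (hL a b) rfl rfl]
    _ = ∑ a : TorusSite 2 M, ∑ b : TorusSite 2 M,
          if β (a + w) = β x ∧ β (b + w) = β y then K (a + w) (b + w) else 0 := by
        rw [← Equiv.sum_comp (Equiv.addRight w)]
        refine Finset.sum_congr rfl fun a _ => ?_
        rw [← Equiv.sum_comp (Equiv.addRight w)]
        rfl
    _ = ∑ a : TorusSite 2 M, ∑ b : TorusSite 2 M,
          if β a = β x - β y ∧ β b = 0 then K a b else 0 := by
        refine Finset.sum_congr rfl fun a _ => Finset.sum_congr rfl fun b _ => ?_
        have h1 : (β (a + w) = β x ∧ β (b + w) = β y) ↔ (β a = β x - β y ∧ β b = 0) := by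
          rw [hshift a, hshift b, eq_sub_iff_add_eq, add_eq_right]
        rw [if_congr h1 (hKw a b) rfl]
    _ = _ := by
        refine Finset.sum_congr rfl fun a _ => Finset.sum_congr rfl fun b _ => ?_
        rw [if_congr (hR a b) rfl rfl]

/-- **The coarse block kernel is even**: `k₂(-X) = k₂(X)` — swap the two summation variables
(symmetry of the raw kernel, `re_expect_raiseLower_symm`) and shift both by the even vector `2X`
(translation invariance). [folklore] -/
theorem coarseKernel_neg (hM : M = 2 * m) (hEven : Even M) (Δ : ℝ)
    (ψ : TensorIndex (TorusSite 2 M) 2 → ℂ)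
    (hψ : ψ ∈ @spinZSector (TorusSite 2 M) _ _ 1 0) (hnorm : star ψ ⬝ᵥ ψ = 1)
    (heig : Matrix.mulVec (xxzHamiltonian 1 (torusGraph 2 M) (-1) Δ) ψ =
      ((lowestEnergyInSector 1 (xxzHamiltonian 1 (torusGraph 2 M) (-1) Δ) 0 : ℝ) : ℂ) • ψ)
    (X : TorusSite 2 m) :
    (∑ x' : TorusSite 2 M, ∑ y' : TorusSite 2 M,
      if (∀ i : Fin 2, (x' i).val / 2 = ((-X) i).val) ∧ (∀ i : Fin 2, (y' i).val / 2 = 0)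
      then (star ψ ⬝ᵥ (onSite x' (spinRaise 1) * onSite y' (spinLower 1)) *ᵥ ψ).re else 0) =
    ∑ x' : TorusSite 2 M, ∑ y' : TorusSite 2 M,
      if (∀ i : Fin 2, (x' i).val / 2 = (X i).val) ∧ (∀ i : Fin 2, (y' i).val / 2 = 0)
      then (star ψ ⬝ᵥ (onSite x' (spinRaise 1) * onSite y' (spinLower 1)) *ᵥ ψ).re else 0 := by
  classical
  set β : TorusSite 2 M → TorusSite 2 m := fun z i => (((z i).val / 2 : ℕ) : ZMod m) with hβ
  set w : TorusSite 2 M := fun j => ((2 * (X j).val : ℕ) : ZMod M) with hw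
  set K : TorusSite 2 M → TorusSite 2 M → ℝ := fun a b =>
    (star ψ ⬝ᵥ (onSite a (spinRaise 1) * onSite b (spinLower 1)) *ᵥ ψ).re with hK
  have hshift : ∀ a : TorusSite 2 M, β (a + w) = β a + X := fun a => coarse_add_double hM a X
  have hKw : ∀ a b : TorusSite 2 M, K (a + w) (b + w) = K a b := fun a b =>
    gs_transverseKernel_translate M hEven Δ ψ hψ hnorm heig w a b
  have hKsymm : ∀ a b : TorusSite 2 M, K a b = K b a := fun a b => re_expect_raiseLower_symm 1 ψ a b
  have hzero : ∀ b : TorusSite 2 M, (∀ i : Fin 2, (b i).val / 2 = 0) ↔ β b = 0 := fun b => by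
    have := block_iff_coarse_eq' hM b (0 : TorusSite 2 m)
    simpa only [Pi.zero_apply, ZMod.val_zero] using this
  have hL : ∀ a b : TorusSite 2 M,
      ((∀ i : Fin 2, (a i).val / 2 = ((-X) i).val) ∧ (∀ i : Fin 2, (b i).val / 2 = 0)) ↔
        (β a = -X ∧ β b = 0) := fun a b => by rw [block_iff_coarse_eq' hM a (-X), hzero b]
  have hR : ∀ a b : TorusSite 2 M,
      ((∀ i : Fin 2, (a i).val / 2 = (X i).val) ∧ (∀ i : Fin 2, (b i).val / 2 = 0)) ↔
        (β a = X ∧ β b = 0) := fun a b => by rw [block_iff_coarse_eq' hM a X, hzero b]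
  symm
  calc (∑ x' : TorusSite 2 M, ∑ y' : TorusSite 2 M,
        if (∀ i : Fin 2, (x' i).val / 2 = (X i).val) ∧ (∀ i : Fin 2, (y' i).val / 2 = 0)
        then K x' y' else 0)
      = ∑ a : TorusSite 2 M, ∑ b : TorusSite 2 M, if β a = X ∧ β b = 0 then K a b else 0 := by
        refine Finset.sum_congr rfl fun a _ => Finset.sum_congr rfl fun b _ => ?_
        rw [if_congr (hR a b) rfl rfl]
    _ = ∑ b : TorusSite 2 M, ∑ a : TorusSite 2 M, if β a = X ∧ β b = 0 then K a b else 0 :=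
        Finset.sum_comm
    _ = ∑ b : TorusSite 2 M, ∑ a : TorusSite 2 M,
          if β (a + w) = X ∧ β (b + w) = 0 then K (a + w) (b + w) else 0 := by
        rw [← Equiv.sum_comp (Equiv.addRight w)]
        refine Finset.sum_congr rfl fun b _ => ?_
        rw [← Equiv.sum_comp (Equiv.addRight w)]
        rfl
    _ = ∑ b : TorusSite 2 M, ∑ a : TorusSite 2 M, if β b = -X ∧ β a = 0 then K b a else 0 := by
        refine Finset.sum_congr rfl fun b _ => Finset.sum_congr rfl fun a _ => ?_
        have h1 : (β (a + w) = X ∧ β (b + w) = 0) ↔ (β b = -X ∧ β a = 0) := by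
          rw [hshift a, hshift b, add_eq_right, add_eq_zero_iff_eq_neg, and_comm]
        rw [if_congr h1 ((hKw a b).trans (hKsymm a b)) rfl]
    _ = _ := by
        refine Finset.sum_congr rfl fun a _ => Finset.sum_congr rfl fun b _ => ?_
        rw [if_congr (hL a b) rfl rfl]

end Block

/-! ### Lévy coefficients ⇒ negative type (registered sub-goal) -/

/-- **Registered sub-goal `stub_blockLogNegType_of_levyCoeff` of crux `Block2InfDivXXZ`: nonnegative
Lévy coefficients imply that `-log K₂` is of negative type.** For even `M` (coarse torus
`(ℤ/(M/2))²`), every real `Δ` and every normalised `S^z_tot = 0` sector ground state `ψ` of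
`xxzHamiltonian 1 (torusGraph 2 M) (-1) Δ`: if for every nonzero coarse momentum `q` the Lévy
coefficient `ν_q = Σ_X log k₂(X) · Re χ_q(X)` of the coarse block kernel
`k₂(X) = Σ_{⌊x'/2⌋ = X, ⌊y'/2⌋ = 0} Re⟨ψ, S⁺_{x'} S⁻_{y'} ψ⟩` is nonnegative, then the fine-indexed
kernel `(x, y) ↦ -log K₂(x, y)` of the crux (stub `stub_blockLogNegType`, verbatim) is negative
definite. Proof: `K₂(x, y) = k₂(β x - β y)` (`block2Kernel_eq_coarse`), `k₂` is even
(`coarseKernel_neg`), and Bochner's theorem on the finite torus in negative-type form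
(`isNegDefKernel_neg_of_factor_torus`). Berg–Christensen–Ressel (1984) Ch. 4 §3; Rudin (1962)
§1.4.3. [folklore] -/
theorem stub_blockLogNegType_of_levyCoeff :
    ∀ (M : ℕ) [NeZero M] [NeZero (M / 2)], Even M → ∀ (Δ : ℝ)
      (ψ : TensorIndex (TorusSite 2 M) 2 → ℂ),
      ψ ∈ @spinZSector (TorusSite 2 M) _ _ 1 0 → star ψ ⬝ᵥ ψ = 1 →
      Matrix.mulVec (xxzHamiltonian 1 (torusGraph 2 M) (-1) Δ) ψ =
        ((lowestEnergyInSector 1 (xxzHamiltonian 1 (torusGraph 2 M) (-1) Δ) 0 : ℝ) : ℂ) • ψ →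
      (∀ q : TorusSite 2 (M / 2), q ≠ 0 →
        0 ≤ ∑ X : TorusSite 2 (M / 2), Real.log (∑ x' : TorusSite 2 M, ∑ y' : TorusSite 2 M,
              if (∀ i : Fin 2, (x' i).val / 2 = (X i).val) ∧ (∀ i : Fin 2, (y' i).val / 2 = 0) then
                (star ψ ⬝ᵥ Matrix.mulVec
                  (onSite x' (spinRaise 1) * onSite y' (spinLower 1)) ψ).re
              else 0) * (torusChar q X).re) →
      IsNegDefKernel fun x y : TorusSite 2 M =>
        -Real.log (∑ x' : TorusSite 2 M, ∑ y' : TorusSite 2 M,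
          if (∀ i : Fin 2, (x' i).val / 2 = (x i).val / 2) ∧
              (∀ i : Fin 2, (y' i).val / 2 = (y i).val / 2) then
            (star ψ ⬝ᵥ Matrix.mulVec
              (onSite x' (spinRaise 1) * onSite y' (spinLower 1)) ψ).re
          else 0) := by
  intro M _ _ hEven Δ ψ hψ hnorm heig hν
  have hM : M = 2 * (M / 2) := (Nat.two_mul_div_two_of_even hEven).symm
  -- the coarse kernel and the factorisation
  set k₂ : TorusSite 2 (M / 2) → ℝ := fun X => ∑ x' : TorusSite 2 M, ∑ y' : TorusSite 2 M,
      if (∀ i : Fin 2, (x' i).val / 2 = (X i).val) ∧ (∀ i : Fin 2, (y' i).val / 2 = 0) then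
        (star ψ ⬝ᵥ Matrix.mulVec (onSite x' (spinRaise 1) * onSite y' (spinLower 1)) ψ).re
      else 0 with hk₂
  refine isNegDefKernel_neg_of_factor_torus (d := 2) (L := M / 2) _
    (fun x : TorusSite 2 M => fun i : Fin 2 => (((x i).val / 2 : ℕ) : ZMod (M / 2)))
    (fun X => Real.log (k₂ X)) (fun x y => ?_) (fun X => ?_) hν
  · -- factorisation
    simp only [hk₂]
    rw [block2Kernel_eq_coarse M hM hEven Δ ψ hψ hnorm heig x y]
  · -- evenness
    simp only [hk₂]
    rw [coarseKernel_neg M hM hEven Δ ψ hψ hnorm heig X]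

/-! ### Assembled form: nonnegative Lévy coefficients imply the crux -/

/-- Kernel → matrix on a finite index type (BCR Ch. 3 §1.2): a positive definite kernel on a
`Fintype` has a positive semidefinite matrix. [cite: BergChristensenRessel1984, Ch. 3 §1.2 (PDF p. 69)] -/
theorem posSemidef_matrix_of_isPosDefKernel {X : Type} [Fintype X] {φ : X → X → ℝ}
    (h : IsPosDefKernel φ) : (Matrix.of fun x y => φ x y).PosSemidef := by
  have hm := h.posSemidef_matrix (Fintype.equivFin X).symm
  exact (Matrix.posSemidef_submatrix_equiv (Fintype.equivFin X).symm).mp hm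

/-- **Schoenberg ⇒ for Hadamard powers** (BCR Ch. 3 Thm. 2.2, finite index type): an entrywise
positive kernel whose `-log` is negative definite has every real Hadamard power `K^{∘s}`, `s > 0`,
positive semidefinite (`K^{∘s} = exp(-s·(-log K))`, `Schoenberg1938_negDef_iff_exp_posDef_holds`).
[cite: BergChristensenRessel1984, Ch. 3 Thm. 2.2 (PDF p. 75)] -/
theorem posSemidef_rpow_of_negLogType {X : Type} [Fintype X] (K : X → X → ℝ)
    (hpos : ∀ x y, 0 < K x y) (hneg : IsNegDefKernel fun x y => -Real.log (K x y))
    (s : ℝ) (hs : 0 < s) : (Matrix.of fun x y => K x y ^ s).PosSemidef := by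
  have hpd : IsPosDefKernel (fun x y => Real.exp (-(s * -Real.log (K x y)))) :=
    (Schoenberg1938_negDef_iff_exp_posDef_holds X _).mp hneg s hs
  have heq : (fun x y => Real.exp (-(s * -Real.log (K x y)))) = fun x y => K x y ^ s := by
    funext x y
    rw [Real.rpow_def_of_pos (hpos x y)]
    congr 1
    ring
  rw [heq] at hpd
  exact posSemidef_matrix_of_isPosDefKernel hpd

/-- **Entrywise positivity of the 2×2-block kernel** of a normalised `S^z_tot = 0` sector ground
state (even `M ≥ 4`, `Δ ∈ [-1,0]`): each block sum contains the strictly positive diagonal-block term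
`(x', y') = (x, y)` of the raw kernel (`stub_transverseKernelPos`, landed) and all terms are
nonnegative. [folklore] -/
theorem block2Kernel_pos (M : ℕ) [NeZero M] (hEven : Even M) (h4 : 4 ≤ M) (Δ : ℝ)
    (hΔ : Δ ∈ Set.Icc (-1:ℝ) 0) (ψ : TensorIndex (TorusSite 2 M) 2 → ℂ)
    (hψ : ψ ∈ @spinZSector (TorusSite 2 M) _ _ 1 0) (hnorm : star ψ ⬝ᵥ ψ = 1)
    (heig : Matrix.mulVec (xxzHamiltonian 1 (torusGraph 2 M) (-1) Δ) ψ =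
      ((lowestEnergyInSector 1 (xxzHamiltonian 1 (torusGraph 2 M) (-1) Δ) 0 : ℝ) : ℂ) • ψ)
    (x y : TorusSite 2 M) :
    0 < ∑ x' : TorusSite 2 M, ∑ y' : TorusSite 2 M,
      (if (∀ i : Fin 2, (x' i).val / 2 = (x i).val / 2) ∧
          (∀ i : Fin 2, (y' i).val / 2 = (y i).val / 2) then
        (star ψ ⬝ᵥ Matrix.mulVec
          (onSite x' (spinRaise 1) * onSite y' (spinLower 1)) ψ).re
      else 0) := by
  have hK : ∀ x' y' : TorusSite 2 M, 0 < (star ψ ⬝ᵥ Matrix.mulVec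
      (onSite x' (spinRaise 1) * onSite y' (spinLower 1)) ψ).re :=
    stub_transverseKernelPos M hEven h4 Δ hΔ ψ hψ hnorm heig
  have hterm : ∀ (x' y' : TorusSite 2 M), 0 ≤
      (if (∀ i : Fin 2, (x' i).val / 2 = (x i).val / 2) ∧
          (∀ i : Fin 2, (y' i).val / 2 = (y i).val / 2) then
        (star ψ ⬝ᵥ Matrix.mulVec
          (onSite x' (spinRaise 1) * onSite y' (spinLower 1)) ψ).re
      else 0) := fun x' y' => by
    split_ifs
    · exact (hK x' y').le
    · exact le_rfl
  have hdiag : 0 < (if (∀ i : Fin 2, (x i).val / 2 = (x i).val / 2) ∧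
          (∀ i : Fin 2, (y i).val / 2 = (y i).val / 2) then
        (star ψ ⬝ᵥ Matrix.mulVec
          (onSite x (spinRaise 1) * onSite y (spinLower 1)) ψ).re
      else 0) := by
    rw [if_pos ⟨fun _ => rfl, fun _ => rfl⟩]
    exact hK x y
  refine lt_of_lt_of_le hdiag (le_trans ?_ (Finset.single_le_sum
    (fun x' _ => Finset.sum_nonneg fun y' _ => hterm x' y') (Finset.mem_univ x)))
  exact Finset.single_le_sum (fun y' _ => hterm x y') (Finset.mem_univ y)

/-- **Nonnegative Lévy coefficients imply the crux `Block2InfDivXXZ`.** If for every even `M ≥ 4`,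
every `Δ ∈ [-1, 0]`, every normalised `S^z_tot = 0` sector ground state `ψ` of `H_M(Δ)` and every
nonzero coarse momentum `q ∈ (ℤ/(M/2))²` the Lévy coefficient
`ν_q = Σ_X log k₂(X) Re χ_q(X)` of the coarse 2×2-block transverse kernel is nonnegative, then every
fractional Hadamard power of the block kernel is positive semidefinite: entrywise positivity
(`block2Kernel_pos`, from the landed `stub_transverseKernelPos`), negative type of `-log K₂`
(`stub_blockLogNegType_of_levyCoeff`), Schoenberg's theorem. This is the EXACT form in which the
numerics (QMC/ED Lévy tables) and the crux idea cards address the crux; the converse also holds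
(sibling file `…LevyEquivalence.lean`). [folklore] -/
theorem Block2InfDivXXZ_of_levyCoeff_nonneg
    (hν : ∀ (M : ℕ) [NeZero M] [NeZero (M / 2)], Even M → 4 ≤ M → ∀ Δ ∈ Set.Icc (-1:ℝ) 0,
      ∀ (ψ : TensorIndex (TorusSite 2 M) 2 → ℂ),
      ψ ∈ @spinZSector (TorusSite 2 M) _ _ 1 0 → star ψ ⬝ᵥ ψ = 1 →
      Matrix.mulVec (xxzHamiltonian 1 (torusGraph 2 M) (-1) Δ) ψ =
        ((lowestEnergyInSector 1 (xxzHamiltonian 1 (torusGraph 2 M) (-1) Δ) 0 : ℝ) : ℂ) • ψ →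
      ∀ q : TorusSite 2 (M / 2), q ≠ 0 →
        0 ≤ ∑ X : TorusSite 2 (M / 2), Real.log (∑ x' : TorusSite 2 M, ∑ y' : TorusSite 2 M,
              if (∀ i : Fin 2, (x' i).val / 2 = (X i).val) ∧ (∀ i : Fin 2, (y' i).val / 2 = 0) then
                (star ψ ⬝ᵥ Matrix.mulVec
                  (onSite x' (spinRaise 1) * onSite y' (spinLower 1)) ψ).re
              else 0) * (torusChar q X).re) :
    Summit.HubbardSuperconductivity.HubbardSuperconductivity.Theses.LevyLogBootstrap.Block2InfDivXXZ := by
  intro M _ hEven h4 Δ hΔ ψ hψ hnorm heig s hs _hs1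
  haveI : NeZero (M / 2) := ⟨by omega⟩
  exact posSemidef_rpow_of_negLogType _ (block2Kernel_pos M hEven h4 Δ hΔ ψ hψ hnorm heig)
    (stub_blockLogNegType_of_levyCoeff M hEven Δ ψ hψ hnorm heig
      (hν M hEven h4 Δ hΔ ψ hψ hnorm heig)) s hs

end Summit.HubbardSuperconductivity.HubbardSuperconductivity.Theorems.LevyLogBootstrap

end
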